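import Literature.Algebra.Homology.GroupHomologyKroneckerDuality
import Mathlib.LinearAlgebra.Trace
import Mathlib.LinearAlgebra.Determinant
import Mathlib.LinearAlgebra.Charpoly.ToMatrix
import Mathlib.LinearAlgebra.Matrix.Dual
import Mathlib.LinearAlgebra.Matrix.Charpoly.Basic
import HarnessLib

/-!
# `α^*` on `Hⁿ(G, K)` and `α_*` on `Hₙ(G, K)` have the same trace, determinant and characteristic
# polynomial (over a field): `α^*` is the transpose of `α_*` under the duality `Hⁿ(G, K) ≅ Hₙ(G, K)^*`
# (Cartan–Eilenberg VI.5.1, natural; Brown V §3 (3.7)/(3.10))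

Topic `Algebra/Homology`; namespace `Literature.Algebra.Homology.GroupKronecker`.  Theorems only; NO
definition, NO named fact, no `sorry`.  Lane `lit-hodgefound` (Track 2, Layer A), seat p30 gen 14, row
g14-#10 of `run/shared/lean/pub/lit-hodgefound/SKELETON.md`.  Built BY NAME on row g14-#1 (= Q2310)
`GroupHomologyKroneckerDuality` §6 (`cohomologyPullback_eq_dualMap`:
`α^* = D_G⁻¹ ∘ (α_*)ᵗ ∘ D_G` for the duality `D_G = kroneckerDualEquiv K G n : Hⁿ(G, K) ≃ Hom_K(Hₙ(G, K), K)`)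
and Mathlib's linear algebra of the transpose (`LinearMap.trace_transpose'`, `LinearMap.det_dualMap`,
`LinearMap.toMatrix_transpose` + `Matrix.charpoly_transpose`) and of conjugation
(`LinearMap.trace_conj'`, `LinearMap.det_conj`, `LinearEquiv.charpoly_conj`).

Source followed.  H. Cartan, S. Eilenberg, *Homological Algebra* (1956), VI §5 Prop. 5.1 [held
`book:cartan1956-homological-algebra` p0104]: over a (self-injective, here) field `K` the evaluation
`ρ : Hⁿ(Hom(X, K)) → Hom(Hₙ(X), K)` is a NATURAL isomorphism; K. S. Brown, *Cohomology of Groups* (1982)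
V §3 (3.7), (3.10), p. 114: `⟨α^* u, z⟩ = ⟨u, α_* z⟩` for a homomorphism `α` (in the tree:
`kroneckerPairingTrivial_naturality`, row g13-#3).  Consequently, for an ENDOMORPHISM `α : G →* G`,
`α^*|Hⁿ(G, K)` is conjugate (by `D_G`) to the transpose of `α_*|Hₙ(G, K)`, and transpose-and-conjugation
invariants agree: trace (the Lefschetz-number ingredient `tr(α^*|Hⁿ) = tr(α_*|Hₙ)`), determinant,
characteristic polynomial — whenever `Hₙ(G, K)` is finite-dimensional (e.g. `G` of type `FP`, or the
lattice `ℤ^ι` of row g14-#2).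

## Contents (`K` a field, `G` a group, `α : G →* G`, `n : ℕ`)
* `cohomologyPullback_eq_conj_dualMap` — `α^* = (D_G⁻¹).conj ((α_*)ᵗ)`;
* **`trace_cohomologyPullback_eq_trace_homologyPushforward`** (`Hₙ(G, K)` finite-dimensional);
* **`det_cohomologyPullback_eq_det_homologyPushforward`**;
* **`charpoly_cohomologyPullback_eq_charpoly_homologyPushforward`**;
* `finite_groupCohomology_of_finite_groupHomology` (`Hⁿ(G, K)` is finite-dimensional when `Hₙ(G, K)` is).

## References
* H. Cartan, S. Eilenberg, *Homological Algebra*, Princeton (1956), VI §5 Prop. 5.1. [CartanEilenberg1956]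
* K. S. Brown, *Cohomology of Groups*, GTM 87, Springer (1982), V §3 (3.7), (3.10), p. 114. [Brown1982CohomologyGroups]
-/

noncomputable section

open CategoryTheory

universe u

namespace Literature.Algebra.Homology.GroupKronecker

section Transpose

variable {K : Type u} {M : Type*} [Field K] [AddCommGroup M] [Module K M] [Module.Finite K M]

/-- The characteristic polynomial of the transpose `fᵗ : M^* → M^*` is that of `f` (matrix transpose in
dual bases). [folklore] -/
private theorem charpoly_dualMap (f : M →ₗ[K] M) : f.dualMap.charpoly = f.charpoly := by
  classical
  let b := Module.Free.chooseBasis K M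
  haveI : Fintype (Module.Free.ChooseBasisIndex K M) := Module.Free.ChooseBasisIndex.fintype K M
  rw [← LinearMap.charpoly_toMatrix f b, ← LinearMap.charpoly_toMatrix f.dualMap b.dualBasis,
    LinearMap.dualMap_def, LinearMap.toMatrix_transpose, Matrix.charpoly_transpose]

end Transpose

section Endomorphism

variable (K : Type u) {G : Type u} [Field K] [Group G] (α : G →* G)

/-- **`α^* = (D_G⁻¹)-conjugate of the transpose `(α_*)ᵗ`** (`D_G = kroneckerDualEquiv K G n`).
[cite: CartanEilenberg1956, VI §5 Prop. 5.1 pp. 119–120] [cite: Brown1982CohomologyGroups, V §3 (3.7), p. 114 and (3.10)] -/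
theorem cohomologyPullback_eq_conj_dualMap (n : ℕ) :
    (cohomologyPullback K α n).hom =
      (kroneckerDualEquiv K G n).symm.conj (homologyPushforward K α n).hom.dualMap := by
  rw [LinearEquiv.conj_apply, LinearEquiv.symm_symm, LinearMap.comp_assoc, cohomologyPullback_eq_dualMap]

/-- `Hⁿ(G, K)` is finite-dimensional as soon as `Hₙ(G, K)` is (`Hⁿ ≅ (Hₙ)^*`).
[cite: CartanEilenberg1956, VI §5 Prop. 5.1 pp. 119–120] -/
theorem finite_groupCohomology_of_finite_groupHomology (n : ℕ)
    [Module.Finite K (groupHomology (Rep.trivial K G K) n)] :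
    Module.Finite K (groupCohomology (Rep.trivial K G K) n) :=
  Module.Finite.equiv (kroneckerDualEquiv K G n).symm

/-- **`tr(α^* | Hⁿ(G, K)) = tr(α_* | Hₙ(G, K))`** for an endomorphism `α` of `G` and `Hₙ(G, K)`
finite-dimensional: `α^*` is conjugate to `(α_*)ᵗ`, and transpose and conjugation preserve the trace
(the degree-`n` term of the Lefschetz number may be computed on either side).
[cite: CartanEilenberg1956, VI §5 Prop. 5.1 pp. 119–120] [cite: Brown1982CohomologyGroups, V §3 (3.7), p. 114 and (3.10)] -/
theorem trace_cohomologyPullback_eq_trace_homologyPushforward (n : ℕ)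
    [Module.Finite K (groupHomology (Rep.trivial K G K) n)] :
    LinearMap.trace K _ (cohomologyPullback K α n).hom =
      LinearMap.trace K _ (homologyPushforward K α n).hom := by
  rw [cohomologyPullback_eq_conj_dualMap, LinearMap.trace_conj', LinearMap.dualMap_def,
    LinearMap.trace_transpose']

/-- **`det(α^* | Hⁿ(G, K)) = det(α_* | Hₙ(G, K))`** (`Hₙ(G, K)` finite-dimensional).
[cite: CartanEilenberg1956, VI §5 Prop. 5.1 pp. 119–120] [cite: Brown1982CohomologyGroups, V §3 (3.7), p. 114 and (3.10)] -/
theorem det_cohomologyPullback_eq_det_homologyPushforward (n : ℕ)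
    [Module.Finite K (groupHomology (Rep.trivial K G K) n)] :
    LinearMap.det (cohomologyPullback K α n).hom = LinearMap.det (homologyPushforward K α n).hom := by
  rw [cohomologyPullback_eq_conj_dualMap, LinearEquiv.conj_apply, LinearMap.comp_assoc, LinearMap.det_conj,
    LinearMap.det_dualMap]

/-- **`α^* | Hⁿ(G, K)` and `α_* | Hₙ(G, K)` have the same characteristic polynomial** (both spaces
finite-dimensional) — hence the same eigenvalues with multiplicities.
[cite: CartanEilenberg1956, VI §5 Prop. 5.1 pp. 119–120] [cite: Brown1982CohomologyGroups, V §3 (3.7), p. 114 and (3.10)] -/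
theorem charpoly_cohomologyPullback_eq_charpoly_homologyPushforward (n : ℕ)
    [Module.Finite K (groupCohomology (Rep.trivial K G K) n)]
    [Module.Finite K (groupHomology (Rep.trivial K G K) n)] :
    (cohomologyPullback K α n).hom.charpoly = (homologyPushforward K α n).hom.charpoly := by
  rw [cohomologyPullback_eq_conj_dualMap, LinearEquiv.charpoly_conj, charpoly_dualMap]

end Endomorphism

end Literature.Algebra.Homology.GroupKronecker
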